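import Literature.LinearAlgebra.HyperinvariantSubspaces
import HarnessLib

/-!
# `Lat A = Lat B ⟹ Hyperlat A = Hyperlat B` and `Lat A ≅ Lat B ⟹ Hyperlat A ≅ Hyperlat B` (Longstaff 1976, Corollaries 3.2.1–3.2.2) for
# arbitrary transformations over an arbitrary field, through the lattice-theoretic recognition of the primary components
# (Brickman–Fillmore 1967, Theorem 1 and §3 item 1)

[topic LinearAlgebra]

Topic `Literature/LinearAlgebra` (namespace `Literature.LinearAlgebra`), lane `lit-hodgefound` (Track 2 foundations library; prover seat
`lit-hodgefound-p34`, generation 49, rows g49-#10 (§1–§3) and g49-#11 (§4)). THEOREMS ONLY (no definition, no instance, no notation, no named fact; net debt `0`).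
Sequel of `Literature.LinearAlgebra.HyperinvariantSubspaces` §10 (`setOf_hyperinvariant_eq_of_forall_mem_invtSubmodule_iff`: Corollary
3.2.1 for PRIMARY `A`) and §2 (`hyperinvariant_iff_forall_primaryComponent`: «`Hyperlat A = ⊗ᵢ Hyperlat (Aᵢ)`»). `L(A) = Lat A` is Mathlib's
`Module.End.invtSubmodule A`; "`𝓜` is `A`-hyperinvariant" is spelled `∀ T, Commute A T → ∀ x ∈ 𝓜, T x ∈ 𝓜`; the primary components are the
tree's `primaryComponent A P` over the monic prime factors `P` of `m_A` (`Literature.LinearAlgebra.PrimaryDecomposition`). "`c ∈ L(A)` SPLITS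
`L(A)`" is written out: `c ∈ L(A) ∧ ∃ c' ∈ L(A), IsCompl c c' ∧ ∀ K ∈ L(A), K = K ⊓ c ⊔ K ⊓ c'` (Brickman–Fillmore's «`L(A) = L(A₁) ⊕ L(A₂)`»).

## Sources, VERBATIM
[Lo76] W. E. Longstaff, *A lattice-theoretic description of the lattice of hyperinvariant subspaces of a linear transformation*, Canad. J.
Math. 28 (1976) 1062–1066 (held text `paper:longstaff1976-…`), p. 1065: **Theorem 3.2** «Let `A` be a transformation acting on a
(finite-dimensional) Hilbert space. There exist sublattices `L₁, L₂, …, L_m` of `Lat A` each of which is irreducible and contains more than one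
element such that `Lat A = ⊕ᵢ Lᵢ`. With these properties the family of sublattices `{Lᵢ : 1 ≤ i ≤ m}` is unique, and `Hyperlat A = ⊕ᵢ Fix (Lᵢ)`.»
(proof: «`W_i = 𝒩((A − αᵢ)^{sᵢ})` … `Lᵢ = Lat (Aᵢ − αᵢ)` is an irreducible sublattice of `Lat A` … `Lat A = ⊕ Lᵢ` [1] and `Hyperlat A = ⊕ Hyperlat
(Aᵢ − αᵢ)` [4] … The uniqueness of the family `{Lᵢ}` follows from the work of Birkhoff»); «The following corollaries are immediate consequences of
this description …» **Corollary 3.2.1** «If `A` and `B` act on the same space and `Lat A = Lat B` then `Hyperlat A = Hyperlat B`.»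
**Corollary 3.2.2** «If `Bᵢ` acts on the space `Hᵢ` (`i = 1, 2`) and `Lat B₁` is isomorphic to `Lat B₂` then `Hyperlat B₁` is isomorphic to `Hyperlat B₂`.»
[BF67] L. Brickman, P. A. Fillmore, *The invariant subspace lattice of a linear transformation*, Canad. J. Math. 19 (1967) 810–822: **Theorem 1**
(p. 812) «`L(A₁ ⊕ A₂) = L(A₁) ⊕ L(A₂)` if and only if the minimum polynomials of `A₁` and `A₂` are relatively prime»; §3 item 1 (p. 815): `A` is
primary iff `L(A)` admits no such decomposition with both summands non-zero (the tree's `forall_isCompl_exists_ne_inf_sup_inf_iff_primary`,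
`exists_ne_inf_sup_inf_of_minpoly_eq_pow`).

## Contents (all proved; any field unless marked)
* §1 Splitting members of `L(A)`: every sum `Σ_{P ∈ S} W_P` of primary components splits `L(A)` with complement `Σ_{P ∉ S} W_P` (B–F Thm. 1 ⟸ with H–K
  §7.5 Lemma «`W = Σ (W ∩ W_P)`»); conversely a splitting pair `(c, c')` has every primary component on one side (`W_P ⊆ c` or `W_P ⊆ c'`, by §3 item 1
  for the primary `A|W_P`), so `c = Σ_{W_P ⊆ c} W_P` (the uniqueness clause of Thm. 3.2, here without Birkhoff's theorem).
* §2 **The primary components are exactly the minimal non-zero splitting members of `L(A)`** (`exists_eq_primaryComponent_iff_minimal_splitting`) — a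
  description of `{W_P}` in terms of the SET `L(A)` alone.
* §3 `Lat A = Lat B` (same set of invariant subspaces) ⟹ `A` and `B` have the same primary components, `Lat (A|W) = Lat (B|W)` on each, and —
  over an infinite field, by the primary case of §10 there — **Corollary 3.2.1: `Hyperlat A = Hyperlat B`** (`setOf_hyperinvariant_eq_of_forall_mem_invtSubmodule_iff'`).
* §4 (any field) a lattice isomorphism `φ : Lat A ≅ Lat B` (`A` on `V`, `B` on `W`) preserves splitting, hence maps primary components to primary
  components (`exists_coe_orderIso_eq_primaryComponent`), induces interval isomorphisms `Lat (A|W_P) ≅ Lat (B|W_Q)`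
  (`exists_orderIso_invtSubmodule_restrict`), and therefore — by the primary case `hyperinvariant_coe_orderIso_of_minpoly_dvd_pow` (§5 there) and
  «`Hyperlat = ⊗ Hyperlat (·|W_P)`» — **Corollary 3.2.2: `φ` carries `Hyperlat A` bijectively onto `Hyperlat B`** (`hyperinvariant_coe_orderIso_of_hyperinvariant`,
  `bijOn_orderIso_setOf_hyperinvariant`); with `φ` the identity, **Corollary 3.2.1 over an arbitrary field**
  (`forall_hyperinvariant_iff_of_forall_mem_invtSubmodule_iff`, `setOf_hyperinvariant_eq_of_invtSubmodule_eq`), superseding the `[Infinite k]` of §3.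

## References
* [Longstaff1976] W. E. Longstaff, Canad. J. Math. 28 (1976) 1062–1066, doi:10.4153/CJM-1976-104-1 — Thm. 3.2, Cor. 3.2.1, Cor. 3.2.2 (p. 1065).
* [BrickmanFillmore1967] L. Brickman, P. A. Fillmore, Canad. J. Math. 19 (1967) 810–822 — Thm. 1 (p. 812), §3 item 1 (p. 815).
* [HoffmanKunze1971LinearAlgebra] K. Hoffman, R. Kunze, *Linear Algebra*, 2nd ed. — §6.8 Thm. 12 (primary decomposition), §7.5 Lemma.
-/

open Module Polynomial UniqueFactorizationMonoid

namespace Literature.LinearAlgebra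

variable {k : Type*} [Field k] {V : Type*} [AddCommGroup V] [Module k V]

/-! ## §1 Splitting members of `L(A)` are the sums of primary components -/

section Splitting

variable [FiniteDimensional k V] (A : Module.End k V)

omit [FiniteDimensional k V] in
/-- A span of invariant subspaces is invariant. [folklore] -/
private theorem iSup_mem_invtSubmodule' {ι : Sort*} {U : ι → Submodule k V} (hU : ∀ i, U i ∈ A.invtSubmodule) :
    (⨆ i, U i) ∈ A.invtSubmodule := by
  rw [Module.End.mem_invtSubmodule_iff_map_le, Submodule.map_iSup]
  exact iSup_mono fun i ↦ (Module.End.mem_invtSubmodule_iff_map_le A).1 (hU i)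

open scoped Classical in
/-- The primary components `W_P` (`P` a prime factor of `m_A`) are non-zero («the subspaces `W_i` are non-zero invariant subspaces of `A`»;
H–K: `d_P ≥ r_P ≥ 1`). [cite: Longstaff1976, Thm. 3.2 proof (p. 1065)] [cite: HoffmanKunze1971LinearAlgebra, §7.2 Thm. 4 (iii)] -/
theorem primaryComponent_ne_bot (P : (normalizedFactors (minpoly k A)).toFinset) : primaryComponent A (P : k[X]) ≠ ⊥ := by
  have hP := Multiset.mem_toFinset.1 P.2
  intro h
  have h1 := count_le_finrank_primaryComponent_div A (P : k[X]) hP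
  rw [h, finrank_bot, Nat.zero_div, Nat.le_zero] at h1
  exact Multiset.count_ne_zero.2 hP h1

open scoped Classical in
/-- **Brickman–Fillmore Theorem 1 (⟸) along the primary decomposition: every sum of primary components `c = Σ_{P ∈ S} W_P` SPLITS `L(A)`** —
`c' = Σ_{P ∉ S} W_P` is an invariant complement and every `K ∈ L(A)` is `K = (K ∩ c) + (K ∩ c')` («`L(A) = Σ_t ⊕ L(A_t)`»; H–K §7.5 Lemma
«`W = (W ∩ W₁) ⊕ ⋯ ⊕ (W ∩ W_k)`», the tree's `iSup_inf_primaryComponent_eq`). [cite: BrickmanFillmore1967, Thm. 1 (p. 812)]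
[cite: HoffmanKunze1971LinearAlgebra, §7.5 Lemma] [cite: Longstaff1976, Thm. 3.2 proof (p. 1065: «`Lat A = ⊕ᵢ Lᵢ`»)] -/
theorem biSup_primaryComponent_splits (S : Set ((normalizedFactors (minpoly k A)).toFinset)) :
    (⨆ P ∈ S, primaryComponent A (P : k[X])) ∈ A.invtSubmodule ∧ (⨆ P ∉ S, primaryComponent A (P : k[X])) ∈ A.invtSubmodule ∧
      IsCompl (⨆ P ∈ S, primaryComponent A (P : k[X])) (⨆ P ∉ S, primaryComponent A (P : k[X])) ∧
      ∀ K ∈ A.invtSubmodule,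
        K = K ⊓ (⨆ P ∈ S, primaryComponent A (P : k[X])) ⊔ K ⊓ (⨆ P ∉ S, primaryComponent A (P : k[X])) := by
  refine ⟨iSup_mem_invtSubmodule' A fun P ↦ iSup_mem_invtSubmodule' A fun _ ↦ primaryComponent_mem_invtSubmodule A _,
    iSup_mem_invtSubmodule' A fun P ↦ iSup_mem_invtSubmodule' A fun _ ↦ primaryComponent_mem_invtSubmodule A _, ⟨?_, ?_⟩, ?_⟩
  · exact (isInternal_primaryComponent A).submodule_iSupIndep.disjoint_biSup_biSup disjoint_compl_right
  · rw [codisjoint_iff, ← iSup_split, (isInternal_primaryComponent A).submodule_iSup_eq_top]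
  · intro K hK
    refine le_antisymm ?_ (sup_le inf_le_left inf_le_left)
    conv_lhs => rw [← iSup_inf_primaryComponent_eq A hK, iSup_split _ (· ∈ S)]
    exact sup_le_sup
      (iSup₂_le fun P hP ↦ le_inf inf_le_left (inf_le_right.trans
        (le_iSup₂ (f := fun (P : (normalizedFactors (minpoly k A)).toFinset) (_ : P ∈ S) ↦ primaryComponent A (P : k[X])) P hP)))
      (iSup₂_le fun P hP ↦ le_inf inf_le_left (inf_le_right.trans
        (le_iSup₂ (f := fun (P : (normalizedFactors (minpoly k A)).toFinset) (_ : P ∉ S) ↦ primaryComponent A (P : k[X])) P hP)))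

open scoped Classical in
/-- **Each primary component `W_P` splits `L(A)`** (the case `S = {P}`; complement `Σ_{Q ≠ P} W_Q`). [cite: BrickmanFillmore1967, Thm. 1 (p. 812)]
[cite: Longstaff1976, Thm. 3.2 proof (p. 1065)] -/
theorem primaryComponent_splits (P : (normalizedFactors (minpoly k A)).toFinset) :
    ∃ c' ∈ A.invtSubmodule, IsCompl (primaryComponent A (P : k[X])) c' ∧
      ∀ K ∈ A.invtSubmodule, K = K ⊓ primaryComponent A (P : k[X]) ⊔ K ⊓ c' := by
  obtain ⟨-, hc', hcc', hsplit⟩ := biSup_primaryComponent_splits A {P}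
  have h1 : (⨆ Q ∈ ({P} : Set ((normalizedFactors (minpoly k A)).toFinset)), primaryComponent A (Q : k[X])) =
      primaryComponent A (P : k[X]) := by
    simp only [Set.mem_singleton_iff, iSup_iSup_eq_left]
  rw [h1] at hcc' hsplit
  exact ⟨_, hc', hcc', hsplit⟩

open scoped Classical in
/-- **Brickman–Fillmore §3 item 1 on the components: a splitting pair `(c, c')` of `L(A)` has every primary component on one side, `W_P ⊆ c`
or `W_P ⊆ c'`** — `(c ∩ W_P, c' ∩ W_P)` would otherwise be a splitting pair of `L(A|W_P)` with both members non-zero, impossible for the primary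
`A|W_P` (the tree's `exists_ne_inf_sup_inf_of_minpoly_eq_pow`; «`Lᵢ = Lat (Aᵢ − αᵢ)` is an irreducible sublattice»). [cite: BrickmanFillmore1967, §3 item 1 (p. 815)]
[cite: Longstaff1976, Thm. 3.2 proof (p. 1065)] -/
theorem primaryComponent_le_or_le_of_splits {c c' : Submodule k V} (hc : c ∈ A.invtSubmodule) (hc' : c' ∈ A.invtSubmodule)
    (hcc' : IsCompl c c') (hsplit : ∀ K ∈ A.invtSubmodule, K = K ⊓ c ⊔ K ⊓ c') (P : (normalizedFactors (minpoly k A)).toFinset) :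
    primaryComponent A (P : k[X]) ≤ c ∨ primaryComponent A (P : k[X]) ≤ c' := by
  have hP := Multiset.mem_toFinset.1 P.2
  have hW : ∀ x ∈ primaryComponent A (P : k[X]), A x ∈ primaryComponent A (P : k[X]) := apply_mem_primaryComponent A (P : k[X])
  have hWsplit := hsplit _ (primaryComponent_mem_invtSubmodule A (P : k[X]))
  by_contra hnot
  push Not at hnot
  obtain ⟨hnc, hnc'⟩ := hnot
  -- the induced pair `(c ∩ W_P, c' ∩ W_P)` inside `W_P`
  have h₁ := comap_subtype_mem_invtSubmodule_restrict A hW hc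
  have h₂ := comap_subtype_mem_invtSubmodule_restrict A hW hc'
  have hne₁ : c.comap (primaryComponent A (P : k[X])).subtype ≠ ⊥ := by
    intro h0
    apply hnc'
    have h : primaryComponent A (P : k[X]) ⊓ c = ⊥ := by rw [← Submodule.map_comap_subtype, h0, Submodule.map_bot]
    rw [hWsplit, h, bot_sup_eq]
    exact inf_le_right
  have hne₂ : c'.comap (primaryComponent A (P : k[X])).subtype ≠ ⊥ := by
    intro h0
    apply hnc
    have h : primaryComponent A (P : k[X]) ⊓ c' = ⊥ := by rw [← Submodule.map_comap_subtype, h0, Submodule.map_bot]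
    rw [hWsplit, h, sup_bot_eq]
    exact inf_le_right
  have hcW : IsCompl (c.comap (primaryComponent A (P : k[X])).subtype) (c'.comap (primaryComponent A (P : k[X])).subtype) := by
    refine ⟨?_, ?_⟩
    · rw [disjoint_iff, ← Submodule.comap_inf, hcc'.inf_eq_bot, Submodule.comap_bot, Submodule.ker_subtype]
    · rw [codisjoint_iff]
      apply Submodule.map_injective_of_injective (primaryComponent A (P : k[X])).injective_subtype
      rw [Submodule.map_sup, Submodule.map_comap_subtype, Submodule.map_comap_subtype, Submodule.map_top, Submodule.range_subtype]
      exact hWsplit.symm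
  have hμW : minpoly k (A.restrict hW) = (P : k[X]) ^ (normalizedFactors (minpoly k A)).count (P : k[X]) :=
    minpoly_restrict_primaryComponent A (P : k[X]) hP
  obtain ⟨N, hN, hNne⟩ := exists_ne_inf_sup_inf_of_minpoly_eq_pow (A.restrict hW) (irreducible_of_normalized_factor _ hP) hμW
    h₁ h₂ hcW hne₁ hne₂
  apply hNne
  apply Submodule.map_injective_of_injective (primaryComponent A (P : k[X])).injective_subtype
  have hNV : N.map (primaryComponent A (P : k[X])).subtype ∈ A.invtSubmodule := (map_subtype_mem_invtSubmodule_iff A hW).2 hN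
  have hNle : N.map (primaryComponent A (P : k[X])).subtype ≤ primaryComponent A (P : k[X]) := Submodule.map_subtype_le _ N
  rw [Submodule.map_sup, Submodule.map_inf _ (primaryComponent A (P : k[X])).injective_subtype,
    Submodule.map_inf _ (primaryComponent A (P : k[X])).injective_subtype, Submodule.map_comap_subtype, Submodule.map_comap_subtype,
    ← inf_assoc, ← inf_assoc, inf_eq_left.2 hNle]
  exact hsplit _ hNV

open scoped Classical in
/-- **A splitting member of `L(A)` is the sum of the primary components it contains: `c = Σ_{W_P ⊆ c} W_P`** (so the splitting members are
exactly the `2^m` sums of primary components — the uniqueness clause «the family `{Lᵢ}` is unique» of Theorem 3.2, here from B–F §3 item 1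
instead of Birkhoff's theorem). [cite: Longstaff1976, Thm. 3.2 (p. 1065)] [cite: BrickmanFillmore1967, Thm. 1 (p. 812), §3 item 1 (p. 815)] -/
theorem eq_biSup_primaryComponent_of_splits {c c' : Submodule k V} (hc : c ∈ A.invtSubmodule) (hc' : c' ∈ A.invtSubmodule)
    (hcc' : IsCompl c c') (hsplit : ∀ K ∈ A.invtSubmodule, K = K ⊓ c ⊔ K ⊓ c') :
    c = ⨆ (P : (normalizedFactors (minpoly k A)).toFinset) (_ : primaryComponent A (P : k[X]) ≤ c), primaryComponent A (P : k[X]) := by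
  refine le_antisymm ?_ (iSup₂_le fun P hP ↦ hP)
  conv_lhs => rw [← iSup_inf_primaryComponent_eq A hc]
  refine iSup_le fun P ↦ ?_
  rcases primaryComponent_le_or_le_of_splits A hc hc' hcc' hsplit P with hP | hP
  · exact inf_le_right.trans (le_iSup₂ (f := fun (P : (normalizedFactors (minpoly k A)).toFinset)
      (_ : primaryComponent A (P : k[X]) ≤ c) ↦ primaryComponent A (P : k[X])) P hP)
  · exact ((inf_le_inf_left c hP).trans hcc'.inf_eq_bot.le).trans bot_le

open scoped Classical in
/-- A non-zero splitting member contains a primary component. [cite: Longstaff1976, Thm. 3.2 (p. 1065)] [cite: BrickmanFillmore1967, Thm. 1 (p. 812)] -/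
theorem exists_primaryComponent_le_of_splits {c c' : Submodule k V} (hc : c ∈ A.invtSubmodule) (hc' : c' ∈ A.invtSubmodule)
    (hcc' : IsCompl c c') (hsplit : ∀ K ∈ A.invtSubmodule, K = K ⊓ c ⊔ K ⊓ c') (hc0 : c ≠ ⊥) :
    ∃ P : (normalizedFactors (minpoly k A)).toFinset, primaryComponent A (P : k[X]) ≤ c := by
  by_contra hnone
  push Not at hnone
  apply hc0
  rw [eq_biSup_primaryComponent_of_splits A hc hc' hcc' hsplit]
  exact iSup_eq_bot.2 fun P ↦ iSup_eq_bot.2 fun hP ↦ absurd hP (hnone P)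

end Splitting

/-! ## §2 The primary components are the minimal non-zero splitting members of `L(A)` -/

section Minimal

variable [FiniteDimensional k V] (A : Module.End k V)

open scoped Classical in
/-- **The primary components `W_P` of `A` are EXACTLY the minimal non-zero splitting members of `L(A)`** — a description of the family `{W_P}`
(Longstaff's `{Lᵢ}`, `Lᵢ = [0, Wᵢ]`) in terms of the set `L(A)` alone. [cite: Longstaff1976, Thm. 3.2 (p. 1065: existence and uniqueness of the
irreducible decomposition `Lat A = ⊕ᵢ Lᵢ`)] [cite: BrickmanFillmore1967, Thm. 1 (p. 812), §3 item 1 (p. 815)] -/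
theorem exists_eq_primaryComponent_iff_minimal_splitting (c : Submodule k V) :
    (∃ P : (normalizedFactors (minpoly k A)).toFinset, c = primaryComponent A (P : k[X])) ↔
      (c ∈ A.invtSubmodule ∧ ∃ c' ∈ A.invtSubmodule, IsCompl c c' ∧ ∀ K ∈ A.invtSubmodule, K = K ⊓ c ⊔ K ⊓ c') ∧ c ≠ ⊥ ∧
        ∀ d : Submodule k V, (d ∈ A.invtSubmodule ∧ ∃ d' ∈ A.invtSubmodule, IsCompl d d' ∧ ∀ K ∈ A.invtSubmodule, K = K ⊓ d ⊔ K ⊓ d') →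
          d ≠ ⊥ → d ≤ c → d = c := by
  constructor
  · rintro ⟨P, rfl⟩
    refine ⟨⟨primaryComponent_mem_invtSubmodule A _, primaryComponent_splits A P⟩, primaryComponent_ne_bot A P, ?_⟩
    rintro d ⟨hd, d', hd', hdd', hsplit⟩ hd0 hdle
    obtain ⟨Q, hQ⟩ := exists_primaryComponent_le_of_splits A hd hd' hdd' hsplit hd0
    have hQP : Q = P := by
      by_contra hne
      exact primaryComponent_ne_bot A Q
        (((isInternal_primaryComponent A).submodule_iSupIndep.pairwiseDisjoint hne).eq_bot_of_le (hQ.trans hdle))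
    subst hQP
    exact le_antisymm hdle hQ
  · rintro ⟨⟨hc, c', hc', hcc', hsplit⟩, hc0, hmin⟩
    obtain ⟨Q, hQ⟩ := exists_primaryComponent_le_of_splits A hc hc' hcc' hsplit hc0
    exact ⟨Q, (hmin _ ⟨primaryComponent_mem_invtSubmodule A _, primaryComponent_splits A Q⟩ (primaryComponent_ne_bot A Q) hQ).symm⟩

open scoped Classical in
/-- **`Lat A = Lat B` ⟹ `A` and `B` have the same primary components** (as subspaces): every `W_P(A)` is a `W_Q(B)`. («If `Lat A = Lat B` …» —
the decomposition `{Lᵢ}` depends on `Lat A` only.) [cite: Longstaff1976, Thm. 3.2, Cor. 3.2.1 (p. 1065)] -/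
theorem exists_primaryComponent_eq_of_forall_mem_invtSubmodule_iff {A B : Module.End k V}
    (h : ∀ M : Submodule k V, M ∈ A.invtSubmodule ↔ M ∈ B.invtSubmodule) (P : (normalizedFactors (minpoly k A)).toFinset) :
    ∃ Q : (normalizedFactors (minpoly k B)).toFinset, primaryComponent A (P : k[X]) = primaryComponent B (Q : k[X]) := by
  have hP := (exists_eq_primaryComponent_iff_minimal_splitting A _).1 ⟨P, rfl⟩
  simp only [h] at hP
  exact (exists_eq_primaryComponent_iff_minimal_splitting B _).2 hP

end Minimal

/-! ## §3 Corollary 3.2.1: `Lat A = Lat B ⟹ Hyperlat A = Hyperlat B` -/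

section SameLattice

variable [FiniteDimensional k V] {A B : Module.End k V}

omit [FiniteDimensional k V] in
/-- Transport of hyperinvariance of `M ∩ W` for `B|W` along an equality of subspaces `W₁ = W₂`. [folklore] -/
private theorem hyperinvariant_restrict_congr {W₁ W₂ : Submodule k V} (e : W₁ = W₂) (h₁ : ∀ x ∈ W₁, B x ∈ W₁) (h₂ : ∀ x ∈ W₂, B x ∈ W₂)
    {M : Submodule k V}
    (hM : ∀ T : Module.End k W₁, Commute (B.restrict h₁) T → ∀ x ∈ M.comap W₁.subtype, T x ∈ M.comap W₁.subtype) :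
    ∀ T : Module.End k W₂, Commute (B.restrict h₂) T → ∀ x ∈ M.comap W₂.subtype, T x ∈ M.comap W₂.subtype := by
  subst e
  exact hM

omit [FiniteDimensional k V] in
/-- `Lat A = Lat B ⟹ Lat (A|W) = Lat (B|W)` for a subspace `W` invariant under both (`L(A|W)` is the interval `[0, W]` of `L(A)`).
[cite: Longstaff1976, Cor. 3.2.1 (p. 1065)] [cite: BrickmanFillmore1967, Thm. 5 proof (p. 816: «`L(A′ᵢ)` is an interval in `L(Aᵢ)`»)] -/
theorem mem_invtSubmodule_restrict_iff_of_forall_mem_invtSubmodule_iff (h : ∀ M : Submodule k V, M ∈ A.invtSubmodule ↔ M ∈ B.invtSubmodule)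
    {W : Submodule k V} (hA : ∀ x ∈ W, A x ∈ W) (hB : ∀ x ∈ W, B x ∈ W) (N : Submodule k W) :
    N ∈ Module.End.invtSubmodule (A.restrict hA) ↔ N ∈ Module.End.invtSubmodule (B.restrict hB) := by
  rw [← map_subtype_mem_invtSubmodule_iff A hA, ← map_subtype_mem_invtSubmodule_iff B hB, h]

open scoped Classical in
/-- `Lat A = Lat B ⟹ Hyperlat A ⊆ Hyperlat B` over an infinite field: a hyperinvariant `M` of `A` has `M ∩ W_P` hyperinvariant for each primary
`A|W_P` (§2 of `HyperinvariantSubspaces`); `W_P(A) = W_Q(B)` =: `W` and `Lat (A|W) = Lat (B|W)`, so `M ∩ W` is hyperinvariant for the primary `B|W`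
by the primary case of Corollary 3.2.1; and `Hyperlat B = ⊗ Hyperlat (B|W_Q)`. [cite: Longstaff1976, Cor. 3.2.1, Thm. 3.2 (p. 1065)] -/
theorem setOf_hyperinvariant_subset_of_forall_mem_invtSubmodule_iff' [Infinite k]
    (h : ∀ M : Submodule k V, M ∈ A.invtSubmodule ↔ M ∈ B.invtSubmodule) :
    {M : Submodule k V | ∀ T : Module.End k V, Commute A T → ∀ x ∈ M, T x ∈ M} ⊆
      {M : Submodule k V | ∀ T : Module.End k V, Commute B T → ∀ x ∈ M, T x ∈ M} := by
  intro M hM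
  rw [Set.mem_setOf_eq, hyperinvariant_iff_forall_primaryComponent B M]
  obtain ⟨hMinv, hMP⟩ := (hyperinvariant_iff_forall_primaryComponent A M).1 hM
  refine ⟨(h M).1 hMinv, fun Q ↦ ?_⟩
  have hsymm : ∀ M : Submodule k V, M ∈ B.invtSubmodule ↔ M ∈ A.invtSubmodule := fun M ↦ (h M).symm
  obtain ⟨P, hPQ⟩ := exists_primaryComponent_eq_of_forall_mem_invtSubmodule_iff hsymm Q
  have hP := Multiset.mem_toFinset.1 P.2
  have hBW : ∀ x ∈ primaryComponent A (P : k[X]), B x ∈ primaryComponent A (P : k[X]) := fun x hx ↦ by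
    rw [← hPQ] at hx ⊢
    exact apply_mem_primaryComponent B (Q : k[X]) x hx
  have hμ : minpoly k (A.restrict (apply_mem_primaryComponent A (P : k[X]))) ∣
      (P : k[X]) ^ (normalizedFactors (minpoly k A)).count (P : k[X]) := by
    rw [minpoly_restrict_primaryComponent A (P : k[X]) hP]
  have hlat := mem_invtSubmodule_restrict_iff_of_forall_mem_invtSubmodule_iff h (apply_mem_primaryComponent A (P : k[X])) hBW
  have heq := setOf_hyperinvariant_eq_of_forall_mem_invtSubmodule_iff (irreducible_of_normalized_factor _ hP)
    (monic_of_mem_normalizedFactors hP) hμ hlat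
  have h1 : M.comap (primaryComponent A (P : k[X])).subtype ∈
      {N : Submodule k (primaryComponent A (P : k[X])) | ∀ T : Module.End k (primaryComponent A (P : k[X])),
        Commute (B.restrict hBW) T → ∀ x ∈ N, T x ∈ N} := by
    rw [← heq]
    exact hMP P
  exact hyperinvariant_restrict_congr hPQ.symm hBW (apply_mem_primaryComponent B (Q : k[X])) h1

/-- **LONGSTAFF COROLLARY 3.2.1 (arbitrary `A`, `B` over an infinite field): «If `A` and `B` act on the same space and `Lat A = Lat B` then
`Hyperlat A = Hyperlat B`.»** [cite: Longstaff1976, Cor. 3.2.1 (p. 1065)] -/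
theorem setOf_hyperinvariant_eq_of_forall_mem_invtSubmodule_iff' [Infinite k]
    (h : ∀ M : Submodule k V, M ∈ A.invtSubmodule ↔ M ∈ B.invtSubmodule) :
    {M : Submodule k V | ∀ T : Module.End k V, Commute A T → ∀ x ∈ M, T x ∈ M} =
      {M : Submodule k V | ∀ T : Module.End k V, Commute B T → ∀ x ∈ M, T x ∈ M} :=
  (setOf_hyperinvariant_subset_of_forall_mem_invtSubmodule_iff' h).antisymm
    (setOf_hyperinvariant_subset_of_forall_mem_invtSubmodule_iff' fun M ↦ (h M).symm)

/-- Corollary 3.2.1 pointwise: if `A` and `B` have the same invariant subspaces then a subspace is `A`-hyperinvariant iff it is `B`-hyperinvariant.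
[cite: Longstaff1976, Cor. 3.2.1 (p. 1065)] -/
theorem hyperinvariant_iff_of_forall_mem_invtSubmodule_iff [Infinite k]
    (h : ∀ M : Submodule k V, M ∈ A.invtSubmodule ↔ M ∈ B.invtSubmodule) (M : Submodule k V) :
    (∀ T : Module.End k V, Commute A T → ∀ x ∈ M, T x ∈ M) ↔ ∀ T : Module.End k V, Commute B T → ∀ x ∈ M, T x ∈ M :=
  Set.ext_iff.1 (setOf_hyperinvariant_eq_of_forall_mem_invtSubmodule_iff' h) M

end SameLattice

/-! ## §4 Corollary 3.2.2: a lattice isomorphism `Lat A ≅ Lat B` carries `Hyperlat A` onto `Hyperlat B` (any field); Corollary 3.2.1 over any field -/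

section Isomorphism

variable {W : Type*} [AddCommGroup W] [Module k W] [FiniteDimensional k V] [FiniteDimensional k W]
  {A : Module.End k V} {B : Module.End k W}

omit [FiniteDimensional k V] in
/-- Splitting read in the lattice `L(A)` itself (complements and the identity `K = K ⊓ c ⊔ K ⊓ c'` computed in the sublattice) is the splitting of
§1. [cite: BrickmanFillmore1967, §1 (p. 811: «`L(A)` is a sublattice of the lattice of all subspaces»), Thm. 1 (p. 812)] -/
theorem exists_isCompl_forall_eq_inf_sup_inf_iff (c : A.invtSubmodule) :
    (∃ c' : A.invtSubmodule, IsCompl c c' ∧ ∀ K : A.invtSubmodule, K = K ⊓ c ⊔ K ⊓ c') ↔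
      ((c : Submodule k V) ∈ A.invtSubmodule ∧ ∃ c' ∈ A.invtSubmodule, IsCompl (c : Submodule k V) c' ∧
        ∀ K ∈ A.invtSubmodule, K = K ⊓ c ⊔ K ⊓ c') := by
  constructor
  · rintro ⟨c', hcc', hK⟩
    refine ⟨c.2, c', c'.2, (Module.End.invtSubmodule.isCompl_iff _).1 hcc', fun K hK' ↦ ?_⟩
    exact congrArg Subtype.val (hK ⟨K, hK'⟩)
  · rintro ⟨-, c', hc', hcc', hK⟩
    exact ⟨⟨c', hc'⟩, (Module.End.invtSubmodule.isCompl_iff _).2 hcc', fun K ↦ Subtype.ext (hK K K.2)⟩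

omit [FiniteDimensional k V] [FiniteDimensional k W] in
/-- A lattice isomorphism `φ : L(A) ≅ L(B)` preserves splitting. [cite: Longstaff1976, Cor. 3.2.2 (p. 1065)] [cite: BrickmanFillmore1967, Thm. 1 (p. 812)] -/
theorem exists_isCompl_forall_eq_inf_sup_inf_iff_orderIso (φ : A.invtSubmodule ≃o B.invtSubmodule) (c : A.invtSubmodule) :
    (∃ c' : A.invtSubmodule, IsCompl c c' ∧ ∀ K : A.invtSubmodule, K = K ⊓ c ⊔ K ⊓ c') ↔
      ∃ c' : B.invtSubmodule, IsCompl (φ c) c' ∧ ∀ K : B.invtSubmodule, K = K ⊓ φ c ⊔ K ⊓ c' := by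
  constructor
  · rintro ⟨c', hcc', hK⟩
    refine ⟨φ c', φ.isCompl hcc', fun K ↦ ?_⟩
    obtain ⟨K, rfl⟩ := φ.surjective K
    rw [← φ.map_inf, ← φ.map_inf, ← φ.map_sup]
    exact congrArg φ (hK K)
  · rintro ⟨c', hcc', hK⟩
    refine ⟨φ.symm c', ?_, fun K ↦ φ.injective ?_⟩
    · have h := φ.symm.isCompl hcc'
      rwa [φ.symm_apply_apply] at h
    · rw [φ.map_sup, φ.map_inf, φ.map_inf, φ.apply_symm_apply]
      exact hK (φ K)

open scoped Classical in
/-- **A lattice isomorphism `φ : Lat A ≅ Lat B` maps the primary components of `A` onto the primary components of `B`** (they are the minimal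
non-zero splitting members, §2, a notion `φ` preserves) — Longstaff's «the family `{Lᵢ}` is unique», transported. [cite: Longstaff1976, Thm. 3.2, Cor. 3.2.2 (p. 1065)] -/
theorem exists_coe_orderIso_eq_primaryComponent (φ : A.invtSubmodule ≃o B.invtSubmodule) (P : (normalizedFactors (minpoly k A)).toFinset) :
    ∃ Q : (normalizedFactors (minpoly k B)).toFinset,
      ((φ ⟨primaryComponent A (P : k[X]), primaryComponent_mem_invtSubmodule A _⟩ : B.invtSubmodule) : Submodule k W) =
        primaryComponent B (Q : k[X]) := by
  have hP := (exists_eq_primaryComponent_iff_minimal_splitting A _).1 ⟨P, rfl⟩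
  obtain ⟨hPs, hP0, hPmin⟩ := hP
  refine (exists_eq_primaryComponent_iff_minimal_splitting B _).2 ⟨?_, ?_, ?_⟩
  · exact (exists_isCompl_forall_eq_inf_sup_inf_iff _).1
      ((exists_isCompl_forall_eq_inf_sup_inf_iff_orderIso φ _).1 ((exists_isCompl_forall_eq_inf_sup_inf_iff _).2 hPs))
  · intro h0
    apply hP0
    have h1 : φ ⟨primaryComponent A (P : k[X]), primaryComponent_mem_invtSubmodule A _⟩ = ⊥ := Subtype.ext h0
    have h2 := congrArg φ.symm h1
    rw [φ.symm_apply_apply, φ.symm.map_bot] at h2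
    exact congrArg Subtype.val h2
  · rintro d hd hd0 hdle
    have h1 : φ (φ.symm ⟨d, hd.1⟩) = ⟨d, hd.1⟩ := φ.apply_symm_apply _
    have hdL := (exists_isCompl_forall_eq_inf_sup_inf_iff (⟨d, hd.1⟩ : B.invtSubmodule)).2 hd
    rw [← h1] at hdL
    have hc := (exists_isCompl_forall_eq_inf_sup_inf_iff _).1 ((exists_isCompl_forall_eq_inf_sup_inf_iff_orderIso φ _).2 hdL)
    have hc0 : ((φ.symm ⟨d, hd.1⟩ : A.invtSubmodule) : Submodule k V) ≠ ⊥ := by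
      intro h0
      apply hd0
      have h2 : φ.symm ⟨d, hd.1⟩ = ⊥ := Subtype.ext h0
      have h3 := congrArg φ h2
      rw [h1, φ.map_bot] at h3
      exact congrArg Subtype.val h3
    have hle : ((φ.symm ⟨d, hd.1⟩ : A.invtSubmodule) : Submodule k V) ≤ primaryComponent A (P : k[X]) := by
      have h4 : φ.symm ⟨d, hd.1⟩ ≤ ⟨primaryComponent A (P : k[X]), primaryComponent_mem_invtSubmodule A _⟩ := by
        rw [← φ.le_iff_le, h1]
        exact hdle
      exact h4
    have heq : φ.symm ⟨d, hd.1⟩ = ⟨primaryComponent A (P : k[X]), primaryComponent_mem_invtSubmodule A _⟩ :=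
      Subtype.ext (hPmin _ hc hc0 hle)
    have h5 := congrArg φ heq
    rw [h1] at h5
    exact congrArg Subtype.val h5

omit [FiniteDimensional k V] [FiniteDimensional k W] in
/-- **The interval isomorphism: `φ : Lat A ≅ Lat B` with `φ(U) = U′` induces `Lat (A|U) ≅ Lat (B|U′)`**, `N ↦ φ(N) ∩ U′` (`L(A|U)` is the interval
`[0, U]` of `L(A)` — the tree's `bijOn_map_subtype_invtSubmodule_restrict`). [cite: BrickmanFillmore1967, Thm. 5 proof (p. 816: «`L(A′ᵢ)` is an interval
in `L(Aᵢ)`»)] [cite: Longstaff1976, Cor. 3.2.2 (p. 1065)] -/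
theorem exists_orderIso_invtSubmodule_restrict (φ : A.invtSubmodule ≃o B.invtSubmodule) {U : Submodule k V} {U' : Submodule k W}
    (hU : ∀ x ∈ U, A x ∈ U) (hU' : ∀ x ∈ U', B x ∈ U')
    (hφU : ((φ ⟨U, (Module.End.mem_invtSubmodule_iff_forall_mem_of_mem A).2 hU⟩ : B.invtSubmodule) : Submodule k W) = U') :
    ∃ ψ : Module.End.invtSubmodule (A.restrict hU) ≃o Module.End.invtSubmodule (B.restrict hU'),
      ∀ N : Module.End.invtSubmodule (A.restrict hU),
        ((ψ N : Module.End.invtSubmodule (B.restrict hU')) : Submodule k U') =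
          ((φ ⟨((N : Submodule k U).map U.subtype), (map_subtype_mem_invtSubmodule_iff A hU).2 N.2⟩ : B.invtSubmodule) :
            Submodule k W).comap U'.subtype := by
  have hUm : U ∈ A.invtSubmodule := (Module.End.mem_invtSubmodule_iff_forall_mem_of_mem A).2 hU
  have hU'm : U' ∈ B.invtSubmodule := (Module.End.mem_invtSubmodule_iff_forall_mem_of_mem B).2 hU'
  have hφU' : φ ⟨U, hUm⟩ = ⟨U', hU'm⟩ := Subtype.ext hφU
  -- the two maps
  have hle₁ : ∀ N : Module.End.invtSubmodule (A.restrict hU),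
      ((φ ⟨(N : Submodule k U).map U.subtype, (map_subtype_mem_invtSubmodule_iff A hU).2 N.2⟩ : B.invtSubmodule) : Submodule k W) ≤ U' := by
    intro N
    have h : φ ⟨(N : Submodule k U).map U.subtype, (map_subtype_mem_invtSubmodule_iff A hU).2 N.2⟩ ≤ ⟨U', hU'm⟩ := by
      rw [← hφU', φ.le_iff_le]
      exact Submodule.map_subtype_le U _
    exact h
  have hle₂ : ∀ N' : Module.End.invtSubmodule (B.restrict hU'),
      ((φ.symm ⟨(N' : Submodule k U').map U'.subtype, (map_subtype_mem_invtSubmodule_iff B hU').2 N'.2⟩ : A.invtSubmodule) :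
        Submodule k V) ≤ U := by
    intro N'
    have h : φ.symm ⟨(N' : Submodule k U').map U'.subtype, (map_subtype_mem_invtSubmodule_iff B hU').2 N'.2⟩ ≤ ⟨U, hUm⟩ := by
      rw [← φ.symm_apply_apply ⟨U, hUm⟩, hφU', φ.symm.le_iff_le]
      exact Submodule.map_subtype_le U' _
    exact h
  refine ⟨{ toFun := fun N ↦ ⟨_, comap_subtype_mem_invtSubmodule_restrict B hU'
              (φ ⟨(N : Submodule k U).map U.subtype, (map_subtype_mem_invtSubmodule_iff A hU).2 N.2⟩).2⟩
            invFun := fun N' ↦ ⟨_, comap_subtype_mem_invtSubmodule_restrict A hU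
              (φ.symm ⟨(N' : Submodule k U').map U'.subtype, (map_subtype_mem_invtSubmodule_iff B hU').2 N'.2⟩).2⟩
            left_inv := fun N ↦ ?_
            right_inv := fun N' ↦ ?_
            map_rel_iff' := ?_ }, fun N ↦ rfl⟩
  · -- `comap_U (φ⁻¹ (map_{U'} (comap_{U'} φ(map_U N)))) = N`
    apply Subtype.ext
    apply Submodule.map_injective_of_injective U.injective_subtype
    have h1 : (⟨((((φ ⟨(N : Submodule k U).map U.subtype, (map_subtype_mem_invtSubmodule_iff A hU).2 N.2⟩ : B.invtSubmodule) :
        Submodule k W).comap U'.subtype).map U'.subtype), (map_subtype_mem_invtSubmodule_iff B hU').2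
          (comap_subtype_mem_invtSubmodule_restrict B hU' (φ ⟨(N : Submodule k U).map U.subtype,
            (map_subtype_mem_invtSubmodule_iff A hU).2 N.2⟩).2)⟩ : B.invtSubmodule) =
        φ ⟨(N : Submodule k U).map U.subtype, (map_subtype_mem_invtSubmodule_iff A hU).2 N.2⟩ :=
      Subtype.ext (show ((((φ ⟨(N : Submodule k U).map U.subtype, (map_subtype_mem_invtSubmodule_iff A hU).2 N.2⟩ : B.invtSubmodule) :
        Submodule k W).comap U'.subtype).map U'.subtype) =
          ((φ ⟨(N : Submodule k U).map U.subtype, (map_subtype_mem_invtSubmodule_iff A hU).2 N.2⟩ : B.invtSubmodule) : Submodule k W) by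
        rw [Submodule.map_comap_subtype, inf_eq_right.2 (hle₁ N)])
    have h2 : (((φ.symm ⟨((((φ ⟨(N : Submodule k U).map U.subtype, (map_subtype_mem_invtSubmodule_iff A hU).2 N.2⟩ : B.invtSubmodule) :
        Submodule k W).comap U'.subtype).map U'.subtype), (map_subtype_mem_invtSubmodule_iff B hU').2
          (comap_subtype_mem_invtSubmodule_restrict B hU' (φ ⟨(N : Submodule k U).map U.subtype,
            (map_subtype_mem_invtSubmodule_iff A hU).2 N.2⟩).2)⟩ : A.invtSubmodule) : Submodule k V).comap U.subtype).map U.subtype =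
        (N : Submodule k U).map U.subtype := by
      rw [h1, φ.symm_apply_apply, Submodule.map_comap_subtype, inf_eq_right]
      exact Submodule.map_subtype_le U _
    exact h2
  · apply Subtype.ext
    apply Submodule.map_injective_of_injective U'.injective_subtype
    have h1 : (⟨((((φ.symm ⟨(N' : Submodule k U').map U'.subtype, (map_subtype_mem_invtSubmodule_iff B hU').2 N'.2⟩ : A.invtSubmodule) :
        Submodule k V).comap U.subtype).map U.subtype), (map_subtype_mem_invtSubmodule_iff A hU).2
          (comap_subtype_mem_invtSubmodule_restrict A hU (φ.symm ⟨(N' : Submodule k U').map U'.subtype,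
            (map_subtype_mem_invtSubmodule_iff B hU').2 N'.2⟩).2)⟩ : A.invtSubmodule) =
        φ.symm ⟨(N' : Submodule k U').map U'.subtype, (map_subtype_mem_invtSubmodule_iff B hU').2 N'.2⟩ :=
      Subtype.ext (show ((((φ.symm ⟨(N' : Submodule k U').map U'.subtype, (map_subtype_mem_invtSubmodule_iff B hU').2 N'.2⟩ :
        A.invtSubmodule) : Submodule k V).comap U.subtype).map U.subtype) =
          ((φ.symm ⟨(N' : Submodule k U').map U'.subtype, (map_subtype_mem_invtSubmodule_iff B hU').2 N'.2⟩ : A.invtSubmodule) :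
            Submodule k V) by
        rw [Submodule.map_comap_subtype, inf_eq_right.2 (hle₂ N')])
    have h2 : (((φ ⟨((((φ.symm ⟨(N' : Submodule k U').map U'.subtype, (map_subtype_mem_invtSubmodule_iff B hU').2 N'.2⟩ :
        A.invtSubmodule) : Submodule k V).comap U.subtype).map U.subtype), (map_subtype_mem_invtSubmodule_iff A hU).2
          (comap_subtype_mem_invtSubmodule_restrict A hU (φ.symm ⟨(N' : Submodule k U').map U'.subtype,
            (map_subtype_mem_invtSubmodule_iff B hU').2 N'.2⟩).2)⟩ : B.invtSubmodule) : Submodule k W).comap U'.subtype).map U'.subtype =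
        (N' : Submodule k U').map U'.subtype := by
      rw [h1, φ.apply_symm_apply, Submodule.map_comap_subtype, inf_eq_right]
      exact Submodule.map_subtype_le U' _
    exact h2
  · intro N₁ N₂
    show ((φ ⟨(N₁ : Submodule k U).map U.subtype, (map_subtype_mem_invtSubmodule_iff A hU).2 N₁.2⟩ : B.invtSubmodule) :
        Submodule k W).comap U'.subtype ≤
      ((φ ⟨(N₂ : Submodule k U).map U.subtype, (map_subtype_mem_invtSubmodule_iff A hU).2 N₂.2⟩ : B.invtSubmodule) :
        Submodule k W).comap U'.subtype ↔ N₁ ≤ N₂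
    constructor
    · intro h
      have h1 := Submodule.map_mono (f := U'.subtype) h
      rw [Submodule.map_comap_subtype, Submodule.map_comap_subtype, inf_eq_right.2 (hle₁ N₁), inf_eq_right.2 (hle₁ N₂)] at h1
      have h2 : φ ⟨(N₁ : Submodule k U).map U.subtype, (map_subtype_mem_invtSubmodule_iff A hU).2 N₁.2⟩ ≤
          φ ⟨(N₂ : Submodule k U).map U.subtype, (map_subtype_mem_invtSubmodule_iff A hU).2 N₂.2⟩ := h1
      rw [φ.le_iff_le] at h2
      exact (Submodule.map_le_map_iff_of_injective U.injective_subtype _ _).1 h2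
    · intro h
      refine Submodule.comap_mono ?_
      have h2 : φ ⟨(N₁ : Submodule k U).map U.subtype, (map_subtype_mem_invtSubmodule_iff A hU).2 N₁.2⟩ ≤
          φ ⟨(N₂ : Submodule k U).map U.subtype, (map_subtype_mem_invtSubmodule_iff A hU).2 N₂.2⟩ := by
        rw [φ.le_iff_le]
        exact Submodule.map_mono h
      exact h2

open scoped Classical in
/-- **LONGSTAFF COROLLARY 3.2.2 (arbitrary transformations, any field), realised by the isomorphism: a lattice isomorphism `φ : Lat A ≅ Lat B`
carries every hyperinvariant subspace of `A` to a hyperinvariant subspace of `B`.** `φ` maps primary components to primary components and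
induces `Lat (A|W_P) ≅ Lat (B|W_Q)`, which carries `Hyperlat (A|W_P)` to `Hyperlat (B|W_Q)` (the primary case, §5 of `HyperinvariantSubspaces`);
and `Hyperlat = ⊗ Hyperlat (·|W)`. [cite: Longstaff1976, Cor. 3.2.2 (p. 1065: «If `B₁` acts on the space `H₁` (`i = 1, 2`) and `Lat B₁` is isomorphic
to `Lat B₂` then `Hyperlat B₁` is isomorphic to `Hyperlat B₂`»), Thm. 3.2] -/
theorem hyperinvariant_coe_orderIso_of_hyperinvariant (φ : A.invtSubmodule ≃o B.invtSubmodule) (N : A.invtSubmodule)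
    (hN : ∀ T : Module.End k V, Commute A T → ∀ x ∈ (N : Submodule k V), T x ∈ (N : Submodule k V)) :
    ∀ T : Module.End k W, Commute B T → ∀ x ∈ ((φ N : B.invtSubmodule) : Submodule k W), T x ∈ ((φ N : B.invtSubmodule) : Submodule k W) := by
  rw [hyperinvariant_iff_forall_primaryComponent B]
  refine ⟨(φ N).2, fun Q ↦ ?_⟩
  obtain ⟨P, hP⟩ := exists_coe_orderIso_eq_primaryComponent φ.symm Q
  have hQm := Multiset.mem_toFinset.1 Q.2
  have hPm := Multiset.mem_toFinset.1 P.2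
  have hWP := apply_mem_primaryComponent A (P : k[X])
  have hWQ := apply_mem_primaryComponent B (Q : k[X])
  have hφP : ((φ ⟨primaryComponent A (P : k[X]), (Module.End.mem_invtSubmodule_iff_forall_mem_of_mem A).2 hWP⟩ : B.invtSubmodule) :
      Submodule k W) = primaryComponent B (Q : k[X]) := by
    have h1 : (⟨primaryComponent A (P : k[X]), (Module.End.mem_invtSubmodule_iff_forall_mem_of_mem A).2 hWP⟩ : A.invtSubmodule) =
        φ.symm ⟨primaryComponent B (Q : k[X]), primaryComponent_mem_invtSubmodule B _⟩ := Subtype.ext hP.symm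
    rw [h1, φ.apply_symm_apply]
  obtain ⟨ψ, hψ⟩ := exists_orderIso_invtSubmodule_restrict φ hWP hWQ hφP
  have hμP : minpoly k (A.restrict hWP) ∣ (P : k[X]) ^ (normalizedFactors (minpoly k A)).count (P : k[X]) := by
    rw [minpoly_restrict_primaryComponent A (P : k[X]) hPm]
  have hμQ : minpoly k (B.restrict hWQ) ∣ (Q : k[X]) ^ (normalizedFactors (minpoly k B)).count (Q : k[X]) := by
    rw [minpoly_restrict_primaryComponent B (Q : k[X]) hQm]
  have hNP := hyperinvariant_comap_subtype_primaryComponent A hN P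
  have hNPm : (N : Submodule k V).comap (primaryComponent A (P : k[X])).subtype ∈ Module.End.invtSubmodule (A.restrict hWP) :=
    comap_subtype_mem_invtSubmodule_restrict A hWP N.2
  have himg := hyperinvariant_coe_orderIso_of_minpoly_dvd_pow (irreducible_of_normalized_factor _ hPm) (monic_of_mem_normalizedFactors hPm)
    hμP (irreducible_of_normalized_factor _ hQm) (monic_of_mem_normalizedFactors hQm) hμQ ψ ⟨_, hNPm⟩ hNP
  rw [hψ] at himg
  -- `φ(N ∩ W_P) ∩ W_Q = φ(N) ∩ W_Q`
  have h2 : (⟨((N : Submodule k V).comap (primaryComponent A (P : k[X])).subtype).map (primaryComponent A (P : k[X])).subtype,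
      (map_subtype_mem_invtSubmodule_iff A hWP).2 hNPm⟩ : A.invtSubmodule) =
        N ⊓ ⟨primaryComponent A (P : k[X]), (Module.End.mem_invtSubmodule_iff_forall_mem_of_mem A).2 hWP⟩ :=
    Subtype.ext (show ((N : Submodule k V).comap (primaryComponent A (P : k[X])).subtype).map (primaryComponent A (P : k[X])).subtype =
        (N : Submodule k V) ⊓ primaryComponent A (P : k[X]) by rw [Submodule.map_comap_subtype, inf_comm])
  have hkey : ((φ ⟨((N : Submodule k V).comap (primaryComponent A (P : k[X])).subtype).map (primaryComponent A (P : k[X])).subtype,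
      (map_subtype_mem_invtSubmodule_iff A hWP).2 hNPm⟩ : B.invtSubmodule) : Submodule k W).comap (primaryComponent B (Q : k[X])).subtype =
        ((φ N : B.invtSubmodule) : Submodule k W).comap (primaryComponent B (Q : k[X])).subtype := by
    rw [h2, φ.map_inf, Sublattice.coe_inf, hφP, Submodule.comap_inf, Submodule.comap_subtype_self, inf_top_eq]
  rw [hkey] at himg
  exact himg

/-- **Corollary 3.2.2 as a bijection: `φ` restricts to a bijection of `Hyperlat A` onto `Hyperlat B`** (so `Hyperlat A ≅ Hyperlat B` as lattices of
subspaces, `φ` being monotone both ways). [cite: Longstaff1976, Cor. 3.2.2 (p. 1065)] -/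
theorem bijOn_orderIso_setOf_hyperinvariant (φ : A.invtSubmodule ≃o B.invtSubmodule) :
    Set.BijOn φ {N : A.invtSubmodule | ∀ T : Module.End k V, Commute A T → ∀ x ∈ (N : Submodule k V), T x ∈ (N : Submodule k V)}
      {N' : B.invtSubmodule | ∀ T : Module.End k W, Commute B T → ∀ x ∈ (N' : Submodule k W), T x ∈ (N' : Submodule k W)} := by
  refine ⟨fun N hN ↦ hyperinvariant_coe_orderIso_of_hyperinvariant φ N hN, φ.injective.injOn, fun N' hN' ↦ ⟨φ.symm N', ?_, φ.apply_symm_apply N'⟩⟩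
  have h := hyperinvariant_coe_orderIso_of_hyperinvariant φ.symm N' hN'
  exact h

end Isomorphism

section AnyField

variable [FiniteDimensional k V] {A B : Module.End k V}

/-- **LONGSTAFF COROLLARY 3.2.1 over an ARBITRARY field: if `A` and `B` have the same invariant subspaces then they have the same hyperinvariant
subspaces** (Cor. 3.2.2 for the identity isomorphism `Lat A = Lat B`; supersedes the `[Infinite k]` versions of §3 and of §10 of
`HyperinvariantSubspaces`). [cite: Longstaff1976, Cor. 3.2.1 (p. 1065)] -/
theorem forall_hyperinvariant_iff_of_forall_mem_invtSubmodule_iff (h : ∀ M : Submodule k V, M ∈ A.invtSubmodule ↔ M ∈ B.invtSubmodule)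
    (M : Submodule k V) :
    (∀ T : Module.End k V, Commute A T → ∀ x ∈ M, T x ∈ M) ↔ ∀ T : Module.End k V, Commute B T → ∀ x ∈ M, T x ∈ M := by
  -- `Lat A ≅ Lat B` by the identity on subspaces
  obtain ⟨e, he, hes⟩ : ∃ e : A.invtSubmodule ≃o B.invtSubmodule,
      (∀ U, ((e U : B.invtSubmodule) : Submodule k V) = U) ∧ ∀ U', ((e.symm U' : A.invtSubmodule) : Submodule k V) = U' :=
    ⟨{ toFun := fun U ↦ ⟨U.1, (h U.1).1 U.2⟩
       invFun := fun U ↦ ⟨U.1, (h U.1).2 U.2⟩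
       left_inv := fun _ ↦ rfl
       right_inv := fun _ ↦ rfl
       map_rel_iff' := Iff.rfl }, fun _ ↦ rfl, fun _ ↦ rfl⟩
  constructor
  · intro hM
    have hMA : M ∈ A.invtSubmodule := (Module.End.mem_invtSubmodule_iff_forall_mem_of_mem A).2 (hM A (Commute.refl A))
    have h1 := hyperinvariant_coe_orderIso_of_hyperinvariant e ⟨M, hMA⟩ hM
    rwa [he] at h1
  · intro hM
    have hMB : M ∈ B.invtSubmodule := (Module.End.mem_invtSubmodule_iff_forall_mem_of_mem B).2 (hM B (Commute.refl B))
    have h1 := hyperinvariant_coe_orderIso_of_hyperinvariant e.symm ⟨M, hMB⟩ hM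
    rwa [hes] at h1

/-- … as an equality of sets, from `Lat A = Lat B` as an equality of sublattices. [cite: Longstaff1976, Cor. 3.2.1 (p. 1065)] -/
theorem setOf_hyperinvariant_eq_of_invtSubmodule_eq (h : A.invtSubmodule = B.invtSubmodule) :
    {M : Submodule k V | ∀ T : Module.End k V, Commute A T → ∀ x ∈ M, T x ∈ M} =
      {M : Submodule k V | ∀ T : Module.End k V, Commute B T → ∀ x ∈ M, T x ∈ M} :=
  Set.ext fun M ↦ forall_hyperinvariant_iff_of_forall_mem_invtSubmodule_iff (fun M ↦ by rw [h]) M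

end AnyField

end Literature.LinearAlgebra
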